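import Literature.Analysis.FluidPDE.AxisymOmegaEnergy
import Literature.Analysis.FluidPDE.AxisymQuotientEquationsJ
import HarnessLib

/-!
# The `L²` energy inequality of `J = ωʳ/r` (Lei–Zhang 2017, §3, (3.1))

Analysis/FluidPDE proof file (theorems only; no definitions, no named facts), sequel of
`AxisymOmegaEnergy.lean` (the `Ω`-inequality) and `AxisymQuotientEquationsJ.lean` (the
`J`-equation), on the discharge path of the named facts
`Literature.Analysis.FluidPDE.LeiZhang2017_logModulus_regularity`,
`…LeiZhang2017_smallSwirl_regularity` and `…Wei2016_logModulus_regularity`.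

Lei–Zhang (arXiv:1505.02628, §3, p. 8, (3.1)): "By applying standard energy estimate to `J`
equation, we have `½ d/dt ‖J‖² = −∫ J(b·∇)J + ∫ J(Δ + (2/r)∂ᵣ)J + ∫ J(ωʳ∂ᵣ + ωᶻ∂_z)(vʳ/r)`",
the transport term vanishes and `∫ J(Δ + (2/r)∂ᵣ)J = −‖∇J‖² − ∫|J(t,0,z)|²dz`, whence
`½ d/dt ‖J‖² + ‖∇J‖² + ∫|J(t,0,z)|² dz = ∫ J (ωʳ∂ᵣ + ωᶻ∂_z)(vʳ/r)`.

* `IsClassicalNSSolutionOn.radVelQuot_curl_energy_le` — the fixed-time form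
  `∫ J J' + ν ∫ |∇J|² ≤ ∫ J · DW[ω]` for a classical axisymmetric solution at `t ∈ S`, with
  `J = radVelQuot (curl (u t))`, `J' = radVelQuot (curl (∂ₜu t))`, `W = radVelQuot (u t)`,
  `ω = curl (u t)` (`DW[ω] = ωʳ∂ᵣW + ωᶻ∂_zW`), under square-integrability hypotheses — the generic
  drift–Laplace energy inequality `integral_energy_le_of_drift_laplacian` (axis term `≤ 0`) applied
  to the pointwise `J`-equation `IsClassicalNSSolutionOn.radVelQuot_curl_eq`.

## Mathlib / tree search

Tree: `integral_energy_le_of_drift_laplacian` (`AxisymOmegaEnergy`),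
`IsClassicalNSSolutionOn.radVelQuot_curl_eq` (`AxisymQuotientEquationsJ`).
`lean search 'radVelQuot_curl_energy'`: nothing before this file.

## References

* Z. Lei, Q. S. Zhang, Pacific J. Math. 289 (2017) 169–187, arXiv:1505.02628, §3 (3.1), p. 8.
  [`LeiZhang2017`]
* D. Wei, J. Math. Anal. Appl. 435 (2016) 402–413, arXiv:1508.03318, §3 (3.1). [`Wei2016`]
-/

noncomputable section

open MeasureTheory Set Function Filter Topology InnerProductSpace WithLp
open scoped RealInnerProductSpace Laplacian ContDiff ENNReal

namespace Literature.Analysis.FluidPDE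

section JEnergy

variable {S : Set ℝ} {ν : ℝ} {v : ℝ → EuclideanSpace ℝ (Fin 3) → EuclideanSpace ℝ (Fin 3)}
  {q : ℝ → EuclideanSpace ℝ (Fin 3) → ℝ}

/-- **The `L²` energy inequality of `J = ωʳ/r`** (Lei–Zhang 2017, §3, (3.1); Wei 2016, (3.1)).
Let `(v, q)` be a classical solution of the unforced Navier–Stokes system with viscosity `ν ≥ 0`
on a time set `S ⊆ closure (interior S)` of unique differentiability, with axisymmetric velocity,
and let `t ∈ S`. Write `J = radVelQuot (curl (v t))`, `J' = radVelQuot (curl (∂ₜv t))`,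
`W = radVelQuot (v t)`, `ω = curl (v t)`. If `J, ∂ᵢJ, ∂ᵢ∂ᵢJ, radDerivQuot J ∈ L²`, `J · DW[ω]` is
integrable and `v t` is bounded with bounded derivative, then
`∫ J J' + ν ∫ |∇J|² ≤ ∫ J · DW[ω]`. [cite: LeiZhang2017, §3 (3.1) (p. 8)] -/
theorem IsClassicalNSSolutionOn.radVelQuot_curl_energy_le (hns : IsClassicalNSSolutionOn S ν 0 v q)
    (hS : UniqueDiffOn ℝ S) (hcl : S ⊆ closure (interior S))
    (hax : ∀ s ∈ S, IsAxisymmetric (v s)) (hν : 0 ≤ ν) {t : ℝ} (ht : t ∈ S)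
    (h0 : MemLp (radVelQuot (curl (v t))) 2 volume)
    (h1 : ∀ i : Fin 3, MemLp (fun x => fderiv ℝ (radVelQuot (curl (v t))) x
      (EuclideanSpace.single i 1)) 2 volume)
    (h2 : ∀ i : Fin 3, MemLp (fun x => fderiv ℝ (fun y => fderiv ℝ (radVelQuot (curl (v t))) y
      (EuclideanSpace.single i 1)) x (EuclideanSpace.single i 1)) 2 volume)
    (hq : MemLp (radDerivQuot (radVelQuot (curl (v t)))) 2 volume)
    (hR : Integrable (fun x => radVelQuot (curl (v t)) x *
      fderiv ℝ (radVelQuot (v t)) x (curl (v t) x)) volume)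
    {B : ℝ} (hbB : ∀ x, ‖v t x‖ ≤ B) {B' : ℝ} (hDb : ∀ x, ‖fderiv ℝ (v t) x‖ ≤ B') :
    (∫ x, radVelQuot (curl (v t)) x * radVelQuot (curl (timeDerivWithin S v t)) x) +
      ν * ∫ x, (fderiv ℝ (radVelQuot (curl (v t))) x (EuclideanSpace.single 0 1) ^ 2 +
        fderiv ℝ (radVelQuot (curl (v t))) x (EuclideanSpace.single 1 1) ^ 2 +
        fderiv ℝ (radVelQuot (curl (v t))) x (EuclideanSpace.single 2 1) ^ 2) ≤
      ∫ x, radVelQuot (curl (v t)) x * fderiv ℝ (radVelQuot (v t)) x (curl (v t) x) := by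
  have hv : ContDiff ℝ ∞ (v t) := hns.contDiff_velocity ht
  have hv1 : ContDiff ℝ 1 (v t) := hv.of_le (by norm_cast)
  have hvd : Differentiable ℝ (v t) := hv.differentiable (by simp)
  have hω : ContDiff ℝ ∞ (curl (v t)) := by
    rw [curl_eq_curlCLM_comp]
    exact curlCLM.contDiff.comp (hv.fderiv_right (m := ∞) (by simp))
  have hω2 : ContDiff ℝ 2 (curl (v t)) := hω.of_le (by norm_cast)
  have hω4 : ContDiff ℝ 4 (curl (v t)) := hω.of_le (by norm_cast)
  have haxω : IsAxisymmetric (curl (v t)) := (hax t ht).curl hvd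
  have hJ2 : ContDiff ℝ 2 (radVelQuot (curl (v t))) := contDiff_radVelQuot (n := 2) hω4
  have hJax : IsAxisymmetricScalar (radVelQuot (curl (v t))) :=
    haxω.isAxisymmetricScalar_radVelQuot hω2
  have heq : ∀ x, radVelQuot (curl (timeDerivWithin S v t)) x +
      fderiv ℝ (radVelQuot (curl (v t))) x (v t x) =
      ν * ((Δ (radVelQuot (curl (v t)))) x + 2 * radDerivQuot (radVelQuot (curl (v t))) x) +
        fderiv ℝ (radVelQuot (v t)) x (curl (v t) x) := fun x =>
    hns.radVelQuot_curl_eq hS hcl hax ht x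
  exact integral_energy_le_of_drift_laplacian hJ2 hJax hν h0 h1 h2 hq hR hv1 (hns.divFree t ht)
    hbB hDb heq

end JEnergy

end Literature.Analysis.FluidPDE
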